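import Mathlib

/-! # Rattaggi's lattice `Γ_{3,5}` (Example 28): quaternion letters and the six relators, kernel-checked

Rattaggi, *Anti-tori in square complex groups*, arXiv:math/0411547 = Geom. Dedicata 114 (2005), §3 and
Example 28: for odd primes `p, l` the group `Γ_{p,l} < ℍ(ℚ)^× / ℚ^×` is generated by the classes of the
integer quaternions of norm `p` (the `a`-letters) and of norm `l` (the `b`-letters) with the parity
normalisation of loc. cit.; it is a torsion-free cocompact lattice in `PGL₂(ℚ_p) × PGL₂(ℚ_l)` acting simply
transitively on the vertices of `T_{p+1} × T_{l+1}` (a `(p+1, l+1)`-group), torsion-free by Thm 4(1) there.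
For `(p, l) = (3, 5)` Example 28 gives the presentation
`Γ_{3,5} = ⟨a₁, a₂, b₁, b₂, b₃ ∣ a₁b₁a₂b₂, a₁b₂a₂b₁⁻¹, a₁b₃a₂⁻¹b₁, a₁b₃⁻¹a₁b₂⁻¹, a₁b₁⁻¹a₂⁻¹b₃, a₂b₃a₂b₂⁻¹⟩`.

This file records the letter assignment used by the `pub-kaplansky` cell's computations
(`a₁ = 1+j+k`, `a₂ = 1+j−k`, `b₁ = 1+2i`, `b₂ = 1+2j`, `b₃ = 1+2k` in the Lipschitz order `ℍ[ℤ]`) and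
verifies by `decide` that the six relators hold PROJECTIVELY: reading an inverse letter as the conjugate
quaternion (`x⁻¹ = x̄ / N(x)` in `ℍ(ℚ)^×`), each relator word multiplies to the nonzero scalar `±15`; hence
the assignment extends to a homomorphism from the presented group to `ℍ(ℚ)^× / ℚ^×`.  We also record the
norms (`3` for the `a`-letters, `5` for the `b`-letters).

Deliberately NOT here (cited, not proved): that this homomorphism is injective with image the lattice
`Γ_{3,5}` and that `Γ_{3,5}` is torsion-free (Rattaggi, Prop. 1 / Thm 4 / Example 28, resting on
Bridson–Wise normal forms and Bridson–Haefliger) — those are what make word-ball computations in the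
quaternion model computations in `Γ_{3,5}`. -/

namespace Literature.GroupTheory.ArithmeticGroups.Rattaggi2004

/-- The Lipschitz quaternions `ℤ + ℤi + ℤj + ℤk` as Mathlib's `ℍ[ℤ,-1,0,-1]`. [folklore] -/
abbrev HZ : Type := QuaternionAlgebra ℤ (-1) 0 (-1)

/-- Componentwise decidable equality (the structure has four integer fields). [folklore] -/
instance : DecidableEq HZ := fun x y =>
  decidable_of_iff (x.re = y.re ∧ x.imI = y.imI ∧ x.imJ = y.imJ ∧ x.imK = y.imK)
    (QuaternionAlgebra.ext_iff).symm

/-- `a₁ = 1 + j + k` (norm 3). [cite: Rattaggi2004, Example 28] -/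
def a₁ : HZ := ⟨1, 0, 1, 1⟩
/-- `a₂ = 1 + j − k` (norm 3). [cite: Rattaggi2004, Example 28] -/
def a₂ : HZ := ⟨1, 0, 1, -1⟩
/-- `b₁ = 1 + 2i` (norm 5). [cite: Rattaggi2004, Example 28] -/
def b₁ : HZ := ⟨1, 2, 0, 0⟩
/-- `b₂ = 1 + 2j` (norm 5). [cite: Rattaggi2004, Example 28] -/
def b₂ : HZ := ⟨1, 0, 2, 0⟩
/-- `b₃ = 1 + 2k` (norm 5). [cite: Rattaggi2004, Example 28] -/
def b₃ : HZ := ⟨1, 0, 0, 2⟩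

/-- The scalar quaternion `n`. [folklore] -/
def scal (n : ℤ) : HZ := ⟨n, 0, 0, 0⟩

/-- Norms: `x x̄ = 3` for the `a`-letters and `5` for the `b`-letters. [cite: Rattaggi2004, §3] -/
theorem letter_norms :
    a₁ * star a₁ = scal 3 ∧ a₂ * star a₂ = scal 3 ∧
    b₁ * star b₁ = scal 5 ∧ b₂ * star b₂ = scal 5 ∧ b₃ * star b₃ = scal 5 := by
  decide

/-- The six relators of Example 28 hold projectively: with inverse letters read as conjugates, each relator
word is the nonzero scalar `±15` in `ℍ[ℤ]`. [cite: Rattaggi2004, Example 28] -/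
theorem relators_projective :
    a₁ * b₁ * a₂ * b₂ = scal (-15) ∧
    a₁ * b₂ * a₂ * star b₁ = scal (-15) ∧
    a₁ * b₃ * star a₂ * b₁ = scal (-15) ∧
    a₁ * star b₃ * a₁ * star b₂ = scal 15 ∧
    a₁ * star b₁ * star a₂ * b₃ = scal (-15) ∧
    a₂ * b₃ * a₂ * star b₂ = scal 15 := by
  decide

/-- The letters pairwise do not commute across types (so the square complex is genuinely two-dimensional at
every corner used): e.g. `a₁ b₁ ≠ b₁ a₁`. [cite: Rattaggi2004, §3] -/
theorem a₁_b₁_noncomm : a₁ * b₁ ≠ b₁ * a₁ := by decide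

end Literature.GroupTheory.ArithmeticGroups.Rattaggi2004
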